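import Mathlib
import HarnessLib
import Literature.Combinatorics.SimpleGraph.LovaszTheta
import Literature.Combinatorics.SimpleGraph.LovaszThetaComplement
import Summits.PneNP.PneNP.Theses.RamseyUncertifiable

/-!
# Route `RamseyUncertifiable`, item `ThetaUncertainty` (stmt-PneNP-9820) — proved

Lovász 1979, Corollary 2: `ϑ(G) · ϑ(Ḡ) ≥ n` for every graph `G` on `n` vertices, here on the
vertex type `Fin n` and over the tree's `Literature.Combinatorics.SimpleGraph.lovaszTheta`.

The mathematics lives in `Literature/Combinatorics/SimpleGraph/LovaszThetaComplement.lean`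
(`card_le_lovaszTheta_mul_lovaszTheta_compl`, Lovász's argument through the dual programme:
a dual-optimal `A` for `G` gives the primal witness `B := (ϑI − A + J)/(nϑ)` for `Ḡ` of value
`≥ n/ϑ(G)`). This file is the `Fin n` wrapper closing the route item: for `n ≥ 1` it is that
theorem with `Fintype.card (Fin n) = n`; for `n = 0` the left-hand side is `0` and the right-hand
side is a product of two nonnegative reals (`lovaszTheta_nonneg`).

References: L. Lovász, *On the Shannon capacity of a graph*, IEEE Trans. Inform. Theory 25 (1979),
Corollary 2 (p. 4); D. E. Knuth, *The sandwich theorem*, Electron. J. Combin. 1 (1994) §6.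
-/

-- the Theorems namespace `Summit.PneNP.PneNP.Theorems` is prescribed by the tree layout
set_option linter.dupNamespace false

namespace Summit.PneNP.PneNP.Theorems

open Literature.Combinatorics.SimpleGraph

/-- **Lovász's uncertainty inequality on `Fin n`** (Lovász 1979, Corollary 2): for every `n` and
every simple graph `G` on `Fin n`, `n ≤ ϑ(G) · ϑ(Gᶜ)`. For `n = 0` both sides are handled by
nonnegativity of `ϑ`; for `n ≥ 1` this is
`Literature.Combinatorics.SimpleGraph.card_le_lovaszTheta_mul_lovaszTheta_compl`. -/
theorem fin_card_le_lovaszTheta_mul_lovaszTheta_compl (n : ℕ) (G : SimpleGraph (Fin n)) :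
    (n : ℝ) ≤ lovaszTheta G * lovaszTheta Gᶜ := by
  rcases Nat.eq_zero_or_pos n with rfl | hn
  · simpa using mul_nonneg (lovaszTheta_nonneg G) (lovaszTheta_nonneg Gᶜ)
  · haveI : Nonempty (Fin n) := ⟨⟨0, hn⟩⟩
    simpa [Fintype.card_fin] using card_le_lovaszTheta_mul_lovaszTheta_compl G

/-- **Route item `ThetaUncertainty` (stmt-PneNP-9820), proved**: the route declaration
`Summit.PneNP.PneNP.Theses.RamseyUncertifiable.ThetaUncertainty` — `∀ n, ∀ G : SimpleGraph (Fin n),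
(n : ℝ) ≤ ϑ(G) · ϑ(Gᶜ)` — holds (Lovász 1979, Corollary 2). -/
theorem thetaUncertainty_proof :
    Summit.PneNP.PneNP.Theses.RamseyUncertifiable.ThetaUncertainty := by
  unfold Summit.PneNP.PneNP.Theses.RamseyUncertifiable.ThetaUncertainty
  exact fin_card_le_lovaszTheta_mul_lovaszTheta_compl

end Summit.PneNP.PneNP.Theorems
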